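import Summits.ValiantsHypothesis.ValiantsHypothesis.Theorems.PolyaContinuedLaplaceRigiditySingKCoreOctic

/-!
# Top-dimensional components of `Sing(per₄)` with exactly one zero line, part 4: no binomial relation
# (the «K-core» of stub B-row of line `component_rigidity`, generic-point half)

Helper file for crux `CoverDecancellation` (stmt-ValiantsHypothesis-17819), line `laplace_rigidity`,
rung row R3 at width 4 (`str₂(per₄) ≥ 5`), read against val-idea-10 g3's line «component_rigidity»
(workfile v4, registered stub `stub_rowPrimeRigidity`; card v4 «LEMMA B», generic-point half
(B-iii)).  K-core setting as in `…SingKCoreLine`/`…SingKCoreOctic`: a prime `P ⊇ subpermIdeal F 4 4 3`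
of height `≤ 8` containing row `i`, rows `j,k,l` and all columns not contained in `P`, a point `z`
with `ker (f ↦ f(z)) = P`, `u = z_j`, `v = z_k`.

* `octic_scale_col` — the octic `Q(u,v) = det M(u,v)` is homogeneous of degree `2` in each column:
  replacing column `c'` by `(μα, μβ)` multiplies it by `μ²`;
* `octicBinomialWitness_ne_zero` — the polynomial `Q` with column `c'` replaced by `(u_c, γ v_c)` (six
  variables) is non-zero: at `u = 𝟙`, `v = (1, γ, 1, −1)` (on `c, c', d, e`) its value is
  `4(γ − 1)²`, at `v = (1, 1, 1, 0)` it is `−12` (`2 ≠ 0`, `3 ≠ 0`);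
* **`binomial_ne_zero`** (T8) — at the generic point of a K-core prime, for all columns `c ≠ c'`
  and all `γ ∈ F`: `u_c v_{c'} ≠ γ · u_{c'} v_c`.  (Otherwise column `c'` of `[u;v]` is
  `(u_{c'}/u_c) · (u_c, γ v_c)`, so `Q(col c' ↦ (u_c, γ v_c)) = 0` is a non-trivial relation among the
  six other coordinates of `u, v`; with `v_{c'}` algebraic this gives `trdeg_F F[u,v] ≤ 6` and, by the
  kernel line, `trdeg_F F[z] ≤ 7 < 8`.)  In ideal terms: such a `P` contains no binomial
  `x_{jc} x_{kc'} − γ x_{jc'} x_{kc}`.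

With `…SingKCoreOctic.coord_ne_zero` (no variables) this is everything the GRADING half of LEMMA B
needs about the generic point: a `(row, column)`-homogeneous quadric of such a `P` is then confined
to the ideal of the row-`i` variables.  Honest framing: structure lemmas; `str₂(per₄) ≥ 5`,
`StrengthTwoPerFour` (stmt-25160), `CentralLaplaceRigidity`, `CoverDecancellation`, VP ≠ VNP are OPEN
and NOT moved; no summit statement is touched.  val-width-17819-w1 g2, 2026-08-28.

References: G. Kirkup, Trans. AMS 360 (2008), Prop. 11 / Thm. 14 [Kirkup2005].
-/

set_option linter.dupNamespace false

noncomputable section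

namespace Summit.ValiantsHypothesis.ValiantsHypothesis.Theorems.PolyaContinuedLaplaceRigidity.SingCodim

open MvPolynomial Cardinal
open Literature.Computability.AlgebraicComplexity
open Literature.Computability.AlgebraicComplexity.BoraleviCarliniMichalekVentura2025

variable {F : Type*} [Field F] {L : Type*} [Field L] [Algebra F L]

/-! ### Column homogeneity of the octic -/

/-- **The octic is homogeneous of degree `2` in each column**: if column `c'` of `[u; v]` is
`(μα, μβ)`, then `Q(u,v) = μ² · Q(u[c' ↦ α], v[c' ↦ β])`. [folklore] -/
theorem octic_scale_col {R : Type*} [CommRing R] (c' : Fin 4) (u v : Fin 4 → R) (μ α β : R)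
    (hu : u c' = μ * α) (hv : v c' = μ * β) :
    ((u 0 * v 1 + u 1 * v 0) * (u 2 * v 3 + u 3 * v 2)) ^ 2 +
        ((u 0 * v 2 + u 2 * v 0) * (u 1 * v 3 + u 3 * v 1)) ^ 2 +
        ((u 0 * v 3 + u 3 * v 0) * (u 1 * v 2 + u 2 * v 1)) ^ 2 -
        2 * ((u 0 * v 1 + u 1 * v 0) * (u 2 * v 3 + u 3 * v 2)) *
          ((u 0 * v 2 + u 2 * v 0) * (u 1 * v 3 + u 3 * v 1)) -
        2 * ((u 0 * v 1 + u 1 * v 0) * (u 2 * v 3 + u 3 * v 2)) *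
          ((u 0 * v 3 + u 3 * v 0) * (u 1 * v 2 + u 2 * v 1)) -
        2 * ((u 0 * v 2 + u 2 * v 0) * (u 1 * v 3 + u 3 * v 1)) *
          ((u 0 * v 3 + u 3 * v 0) * (u 1 * v 2 + u 2 * v 1)) =
      μ ^ 2 *
      ((((Function.update u c' α) 0 * (Function.update v c' β) 1 + (Function.update u c' α) 1 * (Function.update v c' β) 0) * ((Function.update u c' α) 2 * (Function.update v c' β) 3 + (Function.update u c' α) 3 * (Function.update v c' β) 2)) ^ 2 +
        (((Function.update u c' α) 0 * (Function.update v c' β) 2 + (Function.update u c' α) 2 * (Function.update v c' β) 0) * ((Function.update u c' α) 1 * (Function.update v c' β) 3 + (Function.update u c' α) 3 * (Function.update v c' β) 1)) ^ 2 +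
        (((Function.update u c' α) 0 * (Function.update v c' β) 3 + (Function.update u c' α) 3 * (Function.update v c' β) 0) * ((Function.update u c' α) 1 * (Function.update v c' β) 2 + (Function.update u c' α) 2 * (Function.update v c' β) 1)) ^ 2 -
        2 * (((Function.update u c' α) 0 * (Function.update v c' β) 1 + (Function.update u c' α) 1 * (Function.update v c' β) 0) * ((Function.update u c' α) 2 * (Function.update v c' β) 3 + (Function.update u c' α) 3 * (Function.update v c' β) 2)) *
          (((Function.update u c' α) 0 * (Function.update v c' β) 2 + (Function.update u c' α) 2 * (Function.update v c' β) 0) * ((Function.update u c' α) 1 * (Function.update v c' β) 3 + (Function.update u c' α) 3 * (Function.update v c' β) 1)) -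
        2 * (((Function.update u c' α) 0 * (Function.update v c' β) 1 + (Function.update u c' α) 1 * (Function.update v c' β) 0) * ((Function.update u c' α) 2 * (Function.update v c' β) 3 + (Function.update u c' α) 3 * (Function.update v c' β) 2)) *
          (((Function.update u c' α) 0 * (Function.update v c' β) 3 + (Function.update u c' α) 3 * (Function.update v c' β) 0) * ((Function.update u c' α) 1 * (Function.update v c' β) 2 + (Function.update u c' α) 2 * (Function.update v c' β) 1)) -
        2 * (((Function.update u c' α) 0 * (Function.update v c' β) 2 + (Function.update u c' α) 2 * (Function.update v c' β) 0) * ((Function.update u c' α) 1 * (Function.update v c' β) 3 + (Function.update u c' α) 3 * (Function.update v c' β) 1)) *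
          (((Function.update u c' α) 0 * (Function.update v c' β) 3 + (Function.update u c' α) 3 * (Function.update v c' β) 0) * ((Function.update u c' α) 1 * (Function.update v c' β) 2 + (Function.update u c' α) 2 * (Function.update v c' β) 1))) := by
  fin_cases c' <;> simp at hu hv <;> simp [hu, hv] <;> ring

/-! ### The witness: `Q(col c' ↦ (u_c, γ v_c))` is a non-zero polynomial -/

/-- Six indices. -/
theorem card_compl_sum_compl (c' : Fin 4) :
    Fintype.card ({x : Fin 4 // x ≠ c'} ⊕ {x : Fin 4 // x ≠ c'}) = 6 := by
  rw [Fintype.card_sum, Fintype.card_subtype_compl, Fintype.card_fin]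
  simp

/-- **The restricted octic is a non-zero polynomial** in the six variables `u_x, v_x` (`x ≠ c'`):
`Q` with `u_{c'} ↦ u_c`, `v_{c'} ↦ γ v_c`.  Witnesses: `u = 𝟙`, `v_c = 1`, and on the two remaining
columns `(1, −1)` (value `4(γ−1)²`) or, when `γ = 1`, `(1, 0)` (value `−12`). [folklore] -/
theorem octicBinomialWitness_ne_zero (h2 : (2 : F) ≠ 0) (h3 : (3 : F) ≠ 0) {c c' : Fin 4}
    (hcc' : c ≠ c') (γ : F)
    (U V : Fin 4 → MvPolynomial ({x : Fin 4 // x ≠ c'} ⊕ {x : Fin 4 // x ≠ c'}) F)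
    (hU : U = fun x => if hx : x = c' then X (Sum.inl ⟨c, hcc'⟩) else X (Sum.inl ⟨x, hx⟩))
    (hV : V = fun x => if hx : x = c' then C γ * X (Sum.inr ⟨c, hcc'⟩) else X (Sum.inr ⟨x, hx⟩)) :
    ((U 0 * V 1 + U 1 * V 0) * (U 2 * V 3 + U 3 * V 2)) ^ 2 +
        ((U 0 * V 2 + U 2 * V 0) * (U 1 * V 3 + U 3 * V 1)) ^ 2 +
        ((U 0 * V 3 + U 3 * V 0) * (U 1 * V 2 + U 2 * V 1)) ^ 2 -
        2 * ((U 0 * V 1 + U 1 * V 0) * (U 2 * V 3 + U 3 * V 2)) *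
          ((U 0 * V 2 + U 2 * V 0) * (U 1 * V 3 + U 3 * V 1)) -
        2 * ((U 0 * V 1 + U 1 * V 0) * (U 2 * V 3 + U 3 * V 2)) *
          ((U 0 * V 3 + U 3 * V 0) * (U 1 * V 2 + U 2 * V 1)) -
        2 * ((U 0 * V 2 + U 2 * V 0) * (U 1 * V 3 + U 3 * V 1)) *
          ((U 0 * V 3 + U 3 * V 0) * (U 1 * V 2 + U 2 * V 1)) ≠ 0 := by
  classical
  have h12 : (12 : F) ≠ 0 := by
    rw [show (12 : F) = 2 * 2 * 3 by norm_num]; exact mul_ne_zero (mul_ne_zero h2 h2) h3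
  intro hH
  -- witness value on the two columns outside `c, c'`: `(1, t)`, `t = 0` if `γ = 1`, else `t = -1`
  set t : F := if γ = 1 then 0 else -1 with ht
  set pt : ({x : Fin 4 // x ≠ c'} ⊕ {x : Fin 4 // x ≠ c'}) → F := fun s =>
    Sum.elim (fun _ => (1 : F))
      (fun x => if x.1 = c then 1 else if (∀ y : Fin 4, y ≠ c → y ≠ c' → y ≤ x.1) then t else 1) s
    with hpt
  have hUpt : ∀ x, MvPolynomial.eval pt (U x) = 1 := by
    intro x; rw [hU]
    by_cases hx : x = c' <;> simp [hx, hpt]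
  have hVpt : ∀ x, MvPolynomial.eval pt (V x) =
      if x = c' then γ else if x = c then 1 else
        if (∀ y : Fin 4, y ≠ c → y ≠ c' → y ≤ x) then t else 1 := by
    intro x; rw [hV]
    by_cases hx : x = c'
    · subst hx; simp [hpt]
    · simp [hx, hpt]
  have hev := congrArg (MvPolynomial.eval pt) hH
  simp only [map_add, map_sub, map_mul, map_pow, map_ofNat, map_zero, hUpt, hVpt] at hev
  rcases eq_or_ne γ 1 with hγ1 | hγ1
  · have ht0 : t = 0 := by simp [ht, hγ1]
    rw [ht0] at hev
    subst hγ1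
    fin_cases c <;> fin_cases c' <;>
      first
      | exact absurd rfl hcc'
      | (simp +decide at hev
         first
         | exact h12 (by linear_combination hev)
         | exact h12 (by linear_combination -hev))
  · have ht1 : t = -1 := by simp [ht, hγ1]
    rw [ht1] at hev
    fin_cases c <;> fin_cases c' <;>
      first
      | exact absurd rfl hcc'
      | (simp +decide at hev
         rcases hev with h | h <;>
           first
           | exact h2 (by linear_combination h)
           | exact hγ1 (by linear_combination h))

/-! ### T8: no binomial relation -/

/-- **T8 — NO BINOMIAL `u_c v_{c'} = γ u_{c'} v_c` AT THE GENERIC POINT of a K-core prime.**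
Hypotheses as in `trdeg_le_trdeg_rows_add_one` (`2 ≠ 0`, `3 ≠ 0` in `F`); for columns `c ≠ c'`
and any `γ ∈ F`: `z_{jc} z_{kc'} ≠ γ · z_{jc'} z_{kc}`.  Equivalently such a `P` contains no
binomial `x_{jc} x_{kc'} − γ x_{jc'} x_{kc}` (and, with `γ ↦ γ⁻¹` and the rows exchanged, none of the
form `γ x_{jc} x_{kc'} − x_{jc'} x_{kc}`). [cite: Kirkup2005, Thm. 14] -/
theorem binomial_ne_zero (h2 : (2 : F) ≠ 0) (h3 : (3 : F) ≠ 0)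
    {P : Ideal (MvPolynomial (Fin 4 × Fin 4) F)} [P.IsPrime]
    (hle : subpermIdeal F 4 4 3 ≤ P) (h8 : P.height ≤ 8) {i j k l : Fin 4} (hij : i ≠ j) (hik : i ≠ k)
    (hil : i ≠ l) (hjk : j ≠ k) (hjl : j ≠ l) (hkl : k ≠ l)
    (hrow : ∀ c, (X (i, c) : MvPolynomial (Fin 4 × Fin 4) F) ∈ P)
    (hj : ∃ c, (X (j, c) : MvPolynomial (Fin 4 × Fin 4) F) ∉ P)
    (hk : ∃ c, (X (k, c) : MvPolynomial (Fin 4 × Fin 4) F) ∉ P)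
    (hl : ∃ c, (X (l, c) : MvPolynomial (Fin 4 × Fin 4) F) ∉ P)
    (hcol : ∀ c, ∃ ρ, (X (ρ, c) : MvPolynomial (Fin 4 × Fin 4) F) ∉ P)
    (z : Fin 4 × Fin 4 → L) (hker : RingHom.ker (aeval (R := F) z) = P)
    {c c' : Fin 4} (hcc' : c ≠ c') (γ : F) :
    z (j, c) * z (k, c') ≠ algebraMap F L γ * (z (j, c') * z (k, c)) := by
  classical
  intro hb
  set u : Fin 4 → L := fun x => z (j, x) with hu
  set v : Fin 4 → L := fun x => z (k, x) with hv
  set γ' : L := algebraMap F L γ with hγ'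
  -- no coordinate vanishes (T7), for the rows `j` and `k`
  have huc : u c ≠ 0 :=
    coord_ne_zero h2 h3 hle h8 hij hik hil hjk hjl hkl hrow hj hk hl hcol z hker c
  have huc' : u c' ≠ 0 :=
    coord_ne_zero h2 h3 hle h8 hij hik hil hjk hjl hkl hrow hj hk hl hcol z hker c'
  have hvc : v c ≠ 0 :=
    coord_ne_zero h2 h3 hle h8 hik hij hil hjk.symm hkl hjl hrow hk hj hl hcol z hker c
  -- the kernel line (T5), the octic (T6), the lower bound (T3)
  have hT5 := trdeg_le_trdeg_rows_add_one h2 hle h8 hij hik hil hjk hjl hkl hrow hj hk hl hcol z hker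
  have hT6 := octic_eq_zero hle hjk hjl hkl hl z hker
  have h8z := eight_le_trdeg h8 z hker
  -- column `c'` is `μ · (u_c, γ v_c)`
  set μ : L := u c' / u c with hμ
  have hμ0 : μ ≠ 0 := div_ne_zero huc' huc
  have hμu : u c' = μ * u c := by rw [hμ]; field_simp
  have hμv : v c' = μ * (γ' * v c) := by
    rw [hμ]
    field_simp
    linear_combination hb
  have hQ : ((u 0 * v 1 + u 1 * v 0) * (u 2 * v 3 + u 3 * v 2)) ^ 2 +
        ((u 0 * v 2 + u 2 * v 0) * (u 1 * v 3 + u 3 * v 1)) ^ 2 +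
        ((u 0 * v 3 + u 3 * v 0) * (u 1 * v 2 + u 2 * v 1)) ^ 2 -
        2 * ((u 0 * v 1 + u 1 * v 0) * (u 2 * v 3 + u 3 * v 2)) *
          ((u 0 * v 2 + u 2 * v 0) * (u 1 * v 3 + u 3 * v 1)) -
        2 * ((u 0 * v 1 + u 1 * v 0) * (u 2 * v 3 + u 3 * v 2)) *
          ((u 0 * v 3 + u 3 * v 0) * (u 1 * v 2 + u 2 * v 1)) -
        2 * ((u 0 * v 2 + u 2 * v 0) * (u 1 * v 3 + u 3 * v 1)) *
          ((u 0 * v 3 + u 3 * v 0) * (u 1 * v 2 + u 2 * v 1)) = 0 := by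
    simp only [hu, hv]
    linear_combination hT6
  have hscale := octic_scale_col c' u v μ (u c) (γ' * v c) hμu hμv
  have hQ1 : (((Function.update u c' (u c)) 0 * (Function.update v c' (algebraMap F L γ * v c)) 1 + (Function.update u c' (u c)) 1 * (Function.update v c' (algebraMap F L γ * v c)) 0) * ((Function.update u c' (u c)) 2 * (Function.update v c' (algebraMap F L γ * v c)) 3 + (Function.update u c' (u c)) 3 * (Function.update v c' (algebraMap F L γ * v c)) 2)) ^ 2 +
        (((Function.update u c' (u c)) 0 * (Function.update v c' (algebraMap F L γ * v c)) 2 + (Function.update u c' (u c)) 2 * (Function.update v c' (algebraMap F L γ * v c)) 0) * ((Function.update u c' (u c)) 1 * (Function.update v c' (algebraMap F L γ * v c)) 3 + (Function.update u c' (u c)) 3 * (Function.update v c' (algebraMap F L γ * v c)) 1)) ^ 2 +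
        (((Function.update u c' (u c)) 0 * (Function.update v c' (algebraMap F L γ * v c)) 3 + (Function.update u c' (u c)) 3 * (Function.update v c' (algebraMap F L γ * v c)) 0) * ((Function.update u c' (u c)) 1 * (Function.update v c' (algebraMap F L γ * v c)) 2 + (Function.update u c' (u c)) 2 * (Function.update v c' (algebraMap F L γ * v c)) 1)) ^ 2 -
        2 * (((Function.update u c' (u c)) 0 * (Function.update v c' (algebraMap F L γ * v c)) 1 + (Function.update u c' (u c)) 1 * (Function.update v c' (algebraMap F L γ * v c)) 0) * ((Function.update u c' (u c)) 2 * (Function.update v c' (algebraMap F L γ * v c)) 3 + (Function.update u c' (u c)) 3 * (Function.update v c' (algebraMap F L γ * v c)) 2)) *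
          (((Function.update u c' (u c)) 0 * (Function.update v c' (algebraMap F L γ * v c)) 2 + (Function.update u c' (u c)) 2 * (Function.update v c' (algebraMap F L γ * v c)) 0) * ((Function.update u c' (u c)) 1 * (Function.update v c' (algebraMap F L γ * v c)) 3 + (Function.update u c' (u c)) 3 * (Function.update v c' (algebraMap F L γ * v c)) 1)) -
        2 * (((Function.update u c' (u c)) 0 * (Function.update v c' (algebraMap F L γ * v c)) 1 + (Function.update u c' (u c)) 1 * (Function.update v c' (algebraMap F L γ * v c)) 0) * ((Function.update u c' (u c)) 2 * (Function.update v c' (algebraMap F L γ * v c)) 3 + (Function.update u c' (u c)) 3 * (Function.update v c' (algebraMap F L γ * v c)) 2)) *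
          (((Function.update u c' (u c)) 0 * (Function.update v c' (algebraMap F L γ * v c)) 3 + (Function.update u c' (u c)) 3 * (Function.update v c' (algebraMap F L γ * v c)) 0) * ((Function.update u c' (u c)) 1 * (Function.update v c' (algebraMap F L γ * v c)) 2 + (Function.update u c' (u c)) 2 * (Function.update v c' (algebraMap F L γ * v c)) 1)) -
        2 * (((Function.update u c' (u c)) 0 * (Function.update v c' (algebraMap F L γ * v c)) 2 + (Function.update u c' (u c)) 2 * (Function.update v c' (algebraMap F L γ * v c)) 0) * ((Function.update u c' (u c)) 1 * (Function.update v c' (algebraMap F L γ * v c)) 3 + (Function.update u c' (u c)) 3 * (Function.update v c' (algebraMap F L γ * v c)) 1)) *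
          (((Function.update u c' (u c)) 0 * (Function.update v c' (algebraMap F L γ * v c)) 3 + (Function.update u c' (u c)) 3 * (Function.update v c' (algebraMap F L γ * v c)) 0) * ((Function.update u c' (u c)) 1 * (Function.update v c' (algebraMap F L γ * v c)) 2 + (Function.update u c' (u c)) 2 * (Function.update v c' (algebraMap F L γ * v c)) 1)) = 0 := by
    have hμ2 : μ ^ 2 ≠ 0 := pow_ne_zero 2 hμ0
    have h := hQ
    rw [hscale] at h
    rcases mul_eq_zero.1 h with h' | h'
    · exact absurd h' hμ2
    · exact h'
  -- the six other coordinates of `u, v`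
  set ω : ({x : Fin 4 // x ≠ c'} ⊕ {x : Fin 4 // x ≠ c'}) → L :=
    fun s => Sum.elim (fun x => u x.1) (fun x => v x.1) s with hω
  set U : Fin 4 → MvPolynomial ({x : Fin 4 // x ≠ c'} ⊕ {x : Fin 4 // x ≠ c'}) F := fun x =>
    if hx : x = c' then X (Sum.inl ⟨c, hcc'⟩) else X (Sum.inl ⟨x, hx⟩) with hU
  set V : Fin 4 → MvPolynomial ({x : Fin 4 // x ≠ c'} ⊕ {x : Fin 4 // x ≠ c'}) F := fun x =>
    if hx : x = c' then C γ * X (Sum.inr ⟨c, hcc'⟩) else X (Sum.inr ⟨x, hx⟩) with hV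
  have hUω : ∀ x, aeval ω (U x) = Function.update u c' (u c) x := by
    intro x
    by_cases hx : x = c'
    · subst hx; simp [hU, hω]
    · simp [hU, hω, hx]
  have hVω : ∀ x, aeval ω (V x) = Function.update v c' (γ' * v c) x := by
    intro x
    by_cases hx : x = c'
    · subst hx; simp [hV, hω, hγ', Algebra.algebraMap_eq_smul_one]
    · simp [hV, hω, hx]
  have hH : aeval ω (((U 0 * V 1 + U 1 * V 0) * (U 2 * V 3 + U 3 * V 2)) ^ 2 +
        ((U 0 * V 2 + U 2 * V 0) * (U 1 * V 3 + U 3 * V 1)) ^ 2 +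
        ((U 0 * V 3 + U 3 * V 0) * (U 1 * V 2 + U 2 * V 1)) ^ 2 -
        2 * ((U 0 * V 1 + U 1 * V 0) * (U 2 * V 3 + U 3 * V 2)) *
          ((U 0 * V 2 + U 2 * V 0) * (U 1 * V 3 + U 3 * V 1)) -
        2 * ((U 0 * V 1 + U 1 * V 0) * (U 2 * V 3 + U 3 * V 2)) *
          ((U 0 * V 3 + U 3 * V 0) * (U 1 * V 2 + U 2 * V 1)) -
        2 * ((U 0 * V 2 + U 2 * V 0) * (U 1 * V 3 + U 3 * V 1)) *
          ((U 0 * V 3 + U 3 * V 0) * (U 1 * V 2 + U 2 * V 1))) = 0 := by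
    simp only [map_add, map_sub, map_mul, map_pow, map_ofNat, hUω, hVω]
    exact hQ1
  have hH0 := octicBinomialWitness_ne_zero h2 h3 hcc' γ U V rfl rfl
  -- the count: `trdeg F[ω] ≤ 5`, `trdeg F[u,v] ≤ 6`, `trdeg F[z] ≤ 7 < 8`
  have hω5 : Algebra.trdeg F (Algebra.adjoin F (Set.range ω)) ≤ (5 : ℕ) := by
    have h := trdeg_adjoin_range_le_of_aeval_eq_zero_fintype (F := F) ω hH0 hH
    rwa [card_compl_sum_compl] at h
  have hS6 : Algebra.trdeg F (Algebra.adjoin F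
      (Set.range (fun x => z (j, x)) ∪ Set.range (fun x => z (k, x)))) ≤ (5 : ℕ) + 1 := by
    refine le_trans (trdeg_adjoin_le_trdeg_of_forall_alg (T := Set.range ω ∪ {u c'})
      fun y hy => ?_) ((trdeg_adjoin_union_singleton_le (Set.range ω) (u c')).trans
        (add_le_add hω5 le_rfl))
    rcases hy with ⟨x, rfl⟩ | ⟨x, rfl⟩
    · by_cases hx : x = c'
      · subst hx; exact alg_of_mem (Or.inr rfl)
      · exact alg_of_mem (Or.inl ⟨Sum.inl ⟨x, hx⟩, by simp [hω, hu]⟩)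
    · by_cases hx : x = c'
      · subst hx
        -- `v_{c'}` is algebraic: `u_c · v_{c'} = γ' u_{c'} v_c`
        refine alg_of_mul_eq (c := u c) (d := γ' * (u x * v c))
          (Algebra.subset_adjoin (Or.inl ⟨Sum.inl ⟨c, hcc'⟩, by simp [hω, hu]⟩)) ?_ huc ?_
        · refine Subalgebra.mul_mem _ (Subalgebra.algebraMap_mem _ γ) (Subalgebra.mul_mem _
            (Algebra.subset_adjoin (Or.inr rfl))
            (Algebra.subset_adjoin (Or.inl ⟨Sum.inr ⟨c, hcc'⟩, by simp [hω, hv]⟩)))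
        · simp only [hu, hv, hγ'] at hb ⊢
          exact hb
      · exact alg_of_mem (Or.inl ⟨Sum.inr ⟨x, hx⟩, by simp [hω, hv]⟩)
  have h7 : Algebra.trdeg F (Algebra.adjoin F (Set.range z)) ≤ ((5 : ℕ) + 1) + 1 :=
    hT5.trans (add_le_add hS6 le_rfl)
  have : (8 : Cardinal) ≤ ((5 : ℕ) + 1) + 1 := h8z.trans h7
  norm_num at this

end Summit.ValiantsHypothesis.ValiantsHypothesis.Theorems.PolyaContinuedLaplaceRigidity.SingCodim

end
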